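import Literature.Analysis.FluidPDE.NSSliceTimeContinuityProofs
import Literature.Analysis.FluidPDE.NSSpinHeatEquationProofs
import Literature.Analysis.FluidPDE.HarmonicProbe
import HarnessLib

/-!
# Hölder continuity in space–time of bounded local weak solutions with Hölder slices, up to the top

Analysis/FluidPDE proofs file (theorems only; no definitions, no named facts). The accepted
`NSSliceTimeContinuity_holds` (`NSSliceTimeContinuityProofs.lean`; folklore, the role of the
pressure as in Robinson–Rodrigo–Sadowski 2016, §13.5) turns spatially Hölder slices of an
essentially bounded distributional Navier–Stokes solution with `L_{3/2}` pressure on a centred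
cylinder `Q*_R(z) = I × B`, `I = ]t₀ - R², t₀ + R²[`, `B = B(x₀, R)`, into a *continuous*
representative on `Q*_r(z)`, `r < R`. This file proves the quantitative form needed for
ε-regularity statements on closed cylinders (Escauriaza–Seregin–Šverák 2003, Lemma 2.2): a
representative which is **Hölder continuous on `I × B(x₀, r)` for the product metric**, up to
both ends of the time window (`exists_holderOnWith_representative`).

## Proof

The printed mechanism, made quantitative.
1. (`NSSliceTimePairing`, `NSSliceTimeIncrement`, accepted) Testing the equations with
   `χ(t) ρ(x - q) eᵢ` shows that `g(t) = ∫_B ⟪u(t), ρ(· - q) eᵢ⟫` is a.e. equal to `c + ∫ₐᵗ f` with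
   `|∫ₛᵗ f| ≤ A |P(t) - P(s)|`, `P` the pressure clock `∫ₐᵗ (1 + ∫_B |p|)`, and
   `A = |B| (K₁ M² + K₂ M) + 3 K₁` for sup bounds `K₁`, `K₂` of `Dρ`, `Δρ`.
2. (`exists_scaled_bump_bounds`, here) The bumps `ρ_δ(x) = δ⁻³ ρ₁(x/δ)` of radius `δ ≤ 1` have
   `K₁ ≤ k₁ δ⁻⁴`, `K₂ ≤ k₂ δ⁻⁵`; with the radii `δₙ = δ₀/(n + 1)` (a countable family suffices to
   define one full-measure set `T` of good times) every `δ ≤ δ₀` is within a factor `2` of some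
   `δₙ` (`exists_nat_radius_near`).
3. (`abs_pressureClock_sub_le`, here) Hölder's inequality: `|P(t) - P(s)| ≤ |t - s| +
   L |t - s|^{1/3}`, `L = |B|^{1/3} ‖p‖_{L_{3/2}(Q*_R)}`.
4. (`NSSliceTimeBumps.norm_sub_le_of_bump_pairings`, accepted) For good times `t, s` the Hölder
   representatives satisfy `‖v_t(y) - v_s(y)‖ ≤ 6 C δₙ^α + 3 A(δₙ) |P(t) - P(s)|` on `B(x₀, r)`;
   choosing `δₙ ≈ |t - s|^{1/30}` gives `‖v_t(y) - v_s(y)‖ ≤ K |t - s|^κ`, `κ = min(α/30, 1/6)`,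
   for `|t - s|` small, and `≤ 2|M|` always.
5. (`NSSliceTimeLimit`, accepted) The slices are uniformly Cauchy and extend to `W` continuous on
   `I × B(x₀, r)` with `W(t, ·) = v_t`, `t ∈ T`; the time-Hölder and space-Hölder bounds pass from
   the dense set `T` to `I` by continuity, and combine to a Hölder bound for the product (max)
   metric of `ℝ × ℝ³`; `W = u` a.e. by Tonelli.

## References

* J. C. Robinson, J. L. Rodrigo, W. Sadowski, *The three-dimensional Navier–Stokes equations*
  (CUP 2016), §13.5 (time regularity through the pressure). [`RobinsonRodrigoSadowskiCUP2016`]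
* G. Seregin, V. Šverák, Comm. PDE 34 (2009) = arXiv:0804.1803, Def. 2.1 and the remark following
  it. [`SereginSverak2009`]
* L. Escauriaza, G. Seregin, V. Šverák, Russ. Math. Surveys 58 (2003), Lemma 2.2 (Hölder
  continuity on the closed cylinder). [`EscauriazaSereginSverak2003`]
-/

noncomputable section

open MeasureTheory Set Function Filter Topology TopologicalSpace Metric
open scoped NNReal ENNReal InnerProductSpace RealInnerProductSpace Laplacian

namespace Literature.Analysis.FluidPDE

namespace SliceTimeHolder

/-! ### Elementary tools -/

/-- A real bound `‖f x - f y‖ ≤ K d(x, y)^κ` on a set is a `HolderOnWith` bound. [folklore] -/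
theorem holderOnWith_of_norm_sub_le {X Y : Type*} [PseudoMetricSpace X] [NormedAddCommGroup Y]
    {f : X → Y} {s : Set X} {K κ : ℝ≥0}
    (h : ∀ x ∈ s, ∀ y ∈ s, ‖f x - f y‖ ≤ K * dist x y ^ (κ : ℝ)) : HolderOnWith K κ f s := by
  intro x hx y hy
  rw [edist_dist, edist_dist, dist_eq_norm]
  refine (ENNReal.ofReal_le_ofReal (h x hx y hy)).trans_eq ?_
  rw [ENNReal.ofReal_mul' (Real.rpow_nonneg dist_nonneg _), ENNReal.ofReal_coe_nnreal]
  congr 1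
  exact (ENNReal.ofReal_rpow_of_nonneg dist_nonneg κ.2).symm

/-- **Radii within a factor two of a countable family**: for `0 < δ ≤ δ₀` there is `n : ℕ` with
`δ/2 ≤ δ₀/(n + 1) ≤ δ`. [folklore] -/
theorem exists_nat_radius_near {δ₀ δ : ℝ} (hδ : 0 < δ) (hδδ₀ : δ ≤ δ₀) :
    ∃ n : ℕ, δ / 2 ≤ δ₀ / ((n : ℝ) + 1) ∧ δ₀ / ((n : ℝ) + 1) ≤ δ := by
  have hδ₀ : 0 < δ₀ := hδ.trans_le hδδ₀
  have hx : 0 < δ₀ / δ := by positivity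
  set N : ℕ := ⌈δ₀ / δ⌉₊ with hN
  have hN1 : 1 ≤ N := Nat.one_le_ceil_iff.2 hx
  have hNpos : (0 : ℝ) < N := by exact_mod_cast hN1
  have hNle : δ₀ / δ ≤ (N : ℝ) := Nat.le_ceil _
  have hNlt : (N : ℝ) < δ₀ / δ + 1 := Nat.ceil_lt_add_one hx.le
  have hcast : ((N - 1 : ℕ) : ℝ) + 1 = N := by
    rw [Nat.cast_sub hN1]; push_cast; ring
  refine ⟨N - 1, ?_, ?_⟩
  · rw [hcast, div_le_div_iff₀ two_pos hNpos]
    -- `δ N ≤ 2 δ₀` from `N < δ₀/δ + 1` and `δ ≤ δ₀`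
    have h1 : (N : ℝ) * δ < δ₀ + δ := by
      have := mul_lt_mul_of_pos_right hNlt hδ
      rwa [add_mul, div_mul_cancel₀ _ hδ.ne', one_mul] at this
    nlinarith
  · rw [hcast, div_le_iff₀ hNpos]
    have := mul_le_mul_of_nonneg_right hNle hδ.le
    rw [div_mul_cancel₀ _ hδ.ne'] at this
    linarith [mul_comm (N : ℝ) δ]

/-! ### Quantitative bounds for the scaled bumps -/

/-- **The scaled bumps and their derivative bounds.** There are `k₁, k₂ ≥ 0` such that for every
`0 < δ ≤ 1` there is a bump `ρ` at `0` of outer radius `δ` (namely `ρ(x) = ρ₁(x/δ)`, `ρ₁` the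
Mathlib bump with radii `1/2, 1`, so that `ρ.normed = δ⁻³ ρ₁.normed(·/δ)`) with
`‖D(ρ.normed(· - q) v)‖ ≤ k₁ ‖v‖ δ⁻⁴` and `‖Δ(ρ.normed(· - q) v)‖ ≤ k₂ ‖v‖ δ⁻⁵` everywhere, for all
centres `q` and vectors `v`. [folklore] -/
theorem exists_scaled_bump_bounds :
    ∃ k₁ k₂ : ℝ, 0 ≤ k₁ ∧ 0 ≤ k₂ ∧ ∀ δ : ℝ, 0 < δ → δ ≤ 1 →
      ∃ φ : ContDiffBump (0 : EuclideanSpace ℝ (Fin 3)), φ.rOut = δ ∧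
        ∀ (v q x : EuclideanSpace ℝ (Fin 3)),
          ‖fderiv ℝ (fun y => φ.normed volume (y - q) • v) x‖ ≤ k₁ * ‖v‖ / δ ^ 4 ∧
          ‖Δ (fun y => φ.normed volume (y - q) • v) x‖ ≤ k₂ * ‖v‖ / δ ^ 5 := by
  -- the reference bump `ρ₁` and the sup bounds of `Dρ₁`, `Δρ₁`
  let φ₁ : ContDiffBump (0 : EuclideanSpace ℝ (Fin 3)) := ⟨1 / 2, 1, by norm_num, by norm_num⟩
  set g : EuclideanSpace ℝ (Fin 3) → ℝ := φ₁.normed volume with hg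
  have hgs : ContDiff ℝ ((⊤ : ℕ∞) : WithTop ℕ∞) g := φ₁.contDiff_normed
  have hgc : HasCompactSupport g := φ₁.hasCompactSupport_normed
  have hg2 : ContDiff ℝ 2 g := φ₁.contDiff_normed
  have hgd : Differentiable ℝ g := hg2.differentiable (by norm_num)
  obtain ⟨S₁, hS₁⟩ := (hgs.continuous_fderiv (by simp)).bounded_above_of_compact_support
    (hgc.fderiv ℝ)
  have hΔc : HasCompactSupport (Δ g) := hgc.mono' fun x hx => by
    by_contra h
    exact hx (laplacian_eq_zero_of_notMem_tsupport h)
  obtain ⟨S₂, hS₂⟩ := (continuous_laplacian hg2).bounded_above_of_compact_support hΔc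
  have hS₁0 : 0 ≤ S₁ := (norm_nonneg _).trans (hS₁ 0)
  have hS₂0 : 0 ≤ S₂ := (norm_nonneg _).trans (hS₂ 0)
  refine ⟨S₁, S₂, hS₁0, hS₂0, fun δ hδ hδ1 => ?_⟩
  have hδ0 : δ ≠ 0 := hδ.ne'
  -- the scaled bump
  let φ : ContDiffBump (0 : EuclideanSpace ℝ (Fin 3)) := ⟨δ / 2, δ, by positivity, by linarith⟩
  refine ⟨φ, rfl, ?_⟩
  -- `φ = ρ₁(·/δ)`
  have hA : ∀ y : EuclideanSpace ℝ (Fin 3), φ y = φ₁ (δ⁻¹ • y) := by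
    intro y
    rw [ContDiffBump.apply, ContDiffBump.apply]
    have e1 : φ.rOut / φ.rIn = φ₁.rOut / φ₁.rIn := by
      show δ / (δ / 2) = 1 / (1 / 2)
      rw [show (1 : ℝ) / (1 / 2) = 2 by norm_num, div_div_eq_mul_div, mul_div_cancel_left₀ _ hδ0]
    have e2 : φ.rIn⁻¹ • (y - 0) = φ₁.rIn⁻¹ • (δ⁻¹ • y - 0) := by
      show (δ / 2)⁻¹ • (y - 0) = (1 / 2 : ℝ)⁻¹ • (δ⁻¹ • y - 0)
      rw [sub_zero, sub_zero, smul_smul]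
      congr 1
      rw [inv_div, one_div, inv_inv, div_eq_mul_inv, mul_comm]
    rw [e1, e2]
  -- `∫ φ = δ³ ∫ ρ₁`
  have hB : ∫ y, φ y = δ ^ 3 * ∫ y, φ₁ y := by
    simp_rw [hA]
    rw [Measure.integral_comp_inv_smul_of_nonneg volume (φ₁ : EuclideanSpace ℝ (Fin 3) → ℝ) hδ.le]
    simp [smul_eq_mul]
  have hI₁ : 0 < ∫ y, φ₁ y := φ₁.integral_pos
  -- `φ.normed = δ⁻³ ρ₁.normed(·/δ)`
  have hC : (φ.normed volume : EuclideanSpace ℝ (Fin 3) → ℝ) =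
      fun y => (δ ^ 3)⁻¹ • g (δ⁻¹ • y) := by
    funext y
    rw [ContDiffBump.normed_def, hg, ContDiffBump.normed_def, hA y, hB, smul_eq_mul]
    field_simp
  -- the scalar function `h = φ.normed` and its derivatives
  have hhs : ContDiff ℝ 2 (fun y : EuclideanSpace ℝ (Fin 3) => (δ ^ 3)⁻¹ • g (δ⁻¹ • y)) :=
    (hg2.comp (contDiff_const_smul _)).const_smul _
  have hhd : Differentiable ℝ (fun y : EuclideanSpace ℝ (Fin 3) => (δ ^ 3)⁻¹ • g (δ⁻¹ • y)) :=
    hhs.differentiable (by norm_num)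
  have hgsd : ∀ y : EuclideanSpace ℝ (Fin 3), DifferentiableAt ℝ (fun w => g (δ⁻¹ • w)) y :=
    fun y => (hgd.comp (differentiable_id.const_smul δ⁻¹)) y
  have hfd : ∀ y, ‖fderiv ℝ (fun y : EuclideanSpace ℝ (Fin 3) => (δ ^ 3)⁻¹ • g (δ⁻¹ • y)) y‖ ≤
      S₁ / δ ^ 4 := by
    intro y
    have e : fderiv ℝ (fun y : EuclideanSpace ℝ (Fin 3) => (δ ^ 3)⁻¹ • g (δ⁻¹ • y)) y =
        (δ ^ 3)⁻¹ • (δ⁻¹ • fderiv ℝ g (δ⁻¹ • y)) := by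
      rw [fderiv_fun_const_smul (hgsd y), fderiv_comp_smul]
    rw [e, norm_smul, norm_smul, Real.norm_of_nonneg (by positivity),
      Real.norm_of_nonneg (by positivity)]
    calc (δ ^ 3)⁻¹ * (δ⁻¹ * ‖fderiv ℝ g (δ⁻¹ • y)‖) ≤ (δ ^ 3)⁻¹ * (δ⁻¹ * S₁) := by
          gcongr; exact hS₁ _
      _ = S₁ / δ ^ 4 := by field_simp
  have hΔ : ∀ y, ‖Δ (fun y : EuclideanSpace ℝ (Fin 3) => (δ ^ 3)⁻¹ • g (δ⁻¹ • y)) y‖ ≤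
      S₂ / δ ^ 5 := by
    intro y
    rw [laplacian_const_smul_comp_smul g ((δ ^ 3)⁻¹) (inv_ne_zero hδ0) y, norm_smul,
      Real.norm_of_nonneg (by positivity)]
    calc (δ ^ 3)⁻¹ * δ⁻¹ ^ 2 * ‖Δ g (δ⁻¹ • y)‖ ≤ (δ ^ 3)⁻¹ * δ⁻¹ ^ 2 * S₂ := by
          gcongr; exact hS₂ _
      _ = S₂ / δ ^ 5 := by field_simp
  intro v q x
  constructor
  · rw [fderiv_bump_smul, hC, fderiv_smul_const (hhd _), ContinuousLinearMap.norm_smulRight_apply]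
    calc ‖fderiv ℝ (fun y : EuclideanSpace ℝ (Fin 3) => (δ ^ 3)⁻¹ • g (δ⁻¹ • y)) (x - q)‖ * ‖v‖
        ≤ S₁ / δ ^ 4 * ‖v‖ := by gcongr; exact hfd _
      _ = S₁ * ‖v‖ / δ ^ 4 := by ring
  · rw [laplacian_bump_smul, hC, NSSpinHeat.laplacian_smul_const_apply hhs, norm_smul]
    calc ‖Δ (fun y : EuclideanSpace ℝ (Fin 3) => (δ ^ 3)⁻¹ • g (δ⁻¹ • y)) (x - q)‖ * ‖v‖
        ≤ S₂ / δ ^ 5 * ‖v‖ := by gcongr; exact hΔ _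
      _ = S₂ * ‖v‖ / δ ^ 5 := by ring

/-! ### The pressure clock is `1/3`-Hölder -/

/-- `∫ |f| ≤ ‖f‖_{L_{3/2}} |X|^{1/3}` in extended form (Hölder with exponents `3/2`, `3`).
[folklore] -/
theorem lintegral_enorm_le_of_threeHalves {X : Type*} [MeasurableSpace X] {μ : Measure X}
    {f : X → ℝ} (hf : AEMeasurable f μ) :
    ∫⁻ x, ‖f x‖ₑ ∂μ ≤ (∫⁻ x, ‖f x‖ₑ ^ (3 / 2 : ℝ) ∂μ) ^ (2 / 3 : ℝ) * μ univ ^ (1 / 3 : ℝ) := by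
  have hpq : (3 / 2 : ℝ).HolderConjugate 3 :=
    (Real.holderConjugate_iff_eq_conjExponent (by norm_num)).2 (by norm_num)
  have h := ENNReal.lintegral_mul_le_Lp_mul_Lq μ hpq hf.enorm aemeasurable_const
    (f := fun x => ‖f x‖ₑ) (g := fun _ => (1 : ℝ≥0∞))
  simp only [Pi.mul_apply, mul_one, ENNReal.one_rpow, lintegral_const, one_mul] at h
  have e1 : (1 : ℝ) / (3 / 2) = 2 / 3 := by norm_num
  rw [e1] at h
  exact h

/-- **The pressure clock is `1/3`-Hölder**: with `P(t) = ∫_{]a,t]} (1 + ∫_B |p|)` on the closed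
window `[a, b]` of `Q*_R(z) = ]a, b[ × B` and `Λ = ∫∫_{Q*_R(z)} |p|^{3/2} < ∞`,
`|P(t) - P(s)| ≤ |t - s| + (Λ^{2/3} |B|^{1/3}) |t - s|^{1/3}` (Fubini and Hölder's inequality on
`]s, t[ × B`). [folklore] -/
theorem abs_pressureClock_sub_le {p : ℝ → EuclideanSpace ℝ (Fin 3) → ℝ}
    {z : ℝ × EuclideanSpace ℝ (Fin 3)} {R : ℝ}
    (hp : ∫⁻ w in parabolicCylinderCentered R z, ‖p w.1 w.2‖ₑ ^ (3 / 2 : ℝ) < ∞)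
    (hpi : IntegrableOn (uncurry p) (parabolicCylinderCentered R z) volume)
    {s t : ℝ} (hs : s ∈ Icc (z.1 - R ^ 2) (z.1 + R ^ 2)) (ht : t ∈ Icc (z.1 - R ^ 2) (z.1 + R ^ 2)) :
    |(∫ σ in Ioc (z.1 - R ^ 2) t, (1 + ∫ x in ball z.2 R, |p σ x|)) -
        ∫ σ in Ioc (z.1 - R ^ 2) s, (1 + ∫ x in ball z.2 R, |p σ x|)| ≤
      |t - s| + ((∫⁻ w in parabolicCylinderCentered R z, ‖p w.1 w.2‖ₑ ^ (3 / 2 : ℝ)) ^ (2 / 3 : ℝ) *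
        volume (ball z.2 R) ^ (1 / 3 : ℝ)).toReal * |t - s| ^ (1 / 3 : ℝ) := by
  set a : ℝ := z.1 - R ^ 2 with ha
  set b : ℝ := z.1 + R ^ 2 with hb
  set B : Set (EuclideanSpace ℝ (Fin 3)) := ball z.2 R with hB
  set Λ : ℝ≥0∞ := ∫⁻ w in parabolicCylinderCentered R z, ‖p w.1 w.2‖ₑ ^ (3 / 2 : ℝ) with hΛ
  set L : ℝ := (Λ ^ (2 / 3 : ℝ) * volume B ^ (1 / 3 : ℝ)).toReal with hL
  have hL0 : 0 ≤ L := ENNReal.toReal_nonneg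
  set q : ℝ → ℝ := fun σ => ∫ x in B, |p σ x| with hq
  have hq0 : ∀ σ, 0 ≤ q σ := fun σ => integral_nonneg fun x => abs_nonneg _
  have hmi : IntegrableOn (fun σ => 1 + q σ) (Icc a b) := integrableOn_one_add_pressureSlice hpi
  -- symmetric in `s`, `t`: reduce to `s ≤ t`
  wlog hst : s ≤ t generalizing s t
  · have h := this ht hs (le_of_not_ge hst)
    rw [abs_sub_comm] at h
    rw [abs_sub_comm t s]
    exact h
  -- the increment is `∫_{]s,t]} (1 + q) = (t - s) + ∫_{]s,t]} q`
  have hII : ∀ x ∈ Icc a b, ∀ y ∈ Icc a b, IntervalIntegrable (fun σ => 1 + q σ) volume x y :=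
    fun x hx y hy => (hmi.mono_set (uIcc_subset_Icc hx hy)).intervalIntegrable
  have hsub : (∫ σ in Ioc a t, (1 + q σ)) - ∫ σ in Ioc a s, (1 + q σ) = ∫ σ in s..t, (1 + q σ) := by
    rw [← intervalIntegral.integral_of_le ht.1, ← intervalIntegral.integral_of_le hs.1,
      intervalIntegral.integral_interval_sub_left (hII a (left_mem_Icc.2 (hs.1.trans hs.2)) t ht)
        (hII a (left_mem_Icc.2 (hs.1.trans hs.2)) s hs)]
  rw [hsub, intervalIntegral.integral_of_le hst]
  have hIi : IntegrableOn (fun σ => 1 + q σ) (Ioc s t) :=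
    hmi.mono_set (Ioc_subset_Icc_self.trans (Icc_subset_Icc hs.1 ht.2))
  have h1i : IntegrableOn (fun _ : ℝ => (1 : ℝ)) (Ioc s t) volume := integrableOn_const (by simp)
  have hqi : IntegrableOn q (Ioc s t) :=
    (hIi.sub h1i).congr_fun (fun σ _ => by simp) measurableSet_Ioc
  have hsplit : ∫ σ in Ioc s t, (1 + q σ) = (t - s) + ∫ σ in Ioc s t, q σ := by
    rw [integral_add h1i hqi, setIntegral_const, Real.volume_real_Ioc_of_le hst, smul_eq_mul,
      mul_one]
  rw [hsplit]
  -- the pressure part through Fubini and Hölder on `]s, t[ × B`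
  have hE : Ioo s t ×ˢ B ⊆ parabolicCylinderCentered R z :=
    prod_mono (Ioo_subset_Ioo hs.1 ht.2) Subset.rfl
  have hpE : IntegrableOn (uncurry p) (Ioo s t ×ˢ B) volume := hpi.mono_set hE
  have hprod : ∫ σ in Ioc s t, q σ = ∫ w in Ioo s t ×ˢ B, |uncurry p w| := by
    rw [setIntegral_congr_set (Ioo_ae_eq_Ioc (μ := volume) (a := s) (b := t)).symm,
      Measure.volume_eq_prod, setIntegral_prod _ (by
        rw [← Measure.volume_eq_prod]; exact hpE.abs)]
    rfl
  have hlin : ∫ w in Ioo s t ×ˢ B, |uncurry p w| =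
      (∫⁻ w in Ioo s t ×ˢ B, ‖uncurry p w‖ₑ).toReal := by
    rw [← integral_norm_eq_lintegral_enorm hpE.aestronglyMeasurable]
    rfl
  have hHolder : ∫⁻ w in Ioo s t ×ˢ B, ‖uncurry p w‖ₑ ≤
      Λ ^ (2 / 3 : ℝ) * volume B ^ (1 / 3 : ℝ) * ENNReal.ofReal (t - s) ^ (1 / 3 : ℝ) := by
    have h1 := lintegral_enorm_le_of_threeHalves (μ := volume.restrict (Ioo s t ×ˢ B))
      (hpE.aestronglyMeasurable.aemeasurable)
    refine h1.trans ?_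
    have hvol : (volume.restrict (Ioo s t ×ˢ B)) univ = ENNReal.ofReal (t - s) * volume B := by
      rw [Measure.restrict_apply_univ, Measure.volume_eq_prod, Measure.prod_prod, Real.volume_Ioo]
    have h2 : (∫⁻ w in Ioo s t ×ˢ B, ‖uncurry p w‖ₑ ^ (3 / 2 : ℝ)) ≤ Λ := lintegral_mono_set hE
    rw [hvol, ENNReal.mul_rpow_of_nonneg _ _ (by norm_num : (0 : ℝ) ≤ 1 / 3)]
    calc (∫⁻ w in Ioo s t ×ˢ B, ‖uncurry p w‖ₑ ^ (3 / 2 : ℝ)) ^ (2 / 3 : ℝ) *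
          (ENNReal.ofReal (t - s) ^ (1 / 3 : ℝ) * volume B ^ (1 / 3 : ℝ))
        ≤ Λ ^ (2 / 3 : ℝ) * (ENNReal.ofReal (t - s) ^ (1 / 3 : ℝ) * volume B ^ (1 / 3 : ℝ)) := by
          gcongr
      _ = Λ ^ (2 / 3 : ℝ) * volume B ^ (1 / 3 : ℝ) * ENNReal.ofReal (t - s) ^ (1 / 3 : ℝ) := by ring
  have hfin : Λ ^ (2 / 3 : ℝ) * volume B ^ (1 / 3 : ℝ) ≠ ⊤ :=
    ENNReal.mul_ne_top (ENNReal.rpow_ne_top_of_nonneg (by norm_num) hp.ne)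
      (ENNReal.rpow_ne_top_of_nonneg (by norm_num) measure_ball_lt_top.ne)
  have hq_le : ∫ σ in Ioc s t, q σ ≤ L * (t - s) ^ (1 / 3 : ℝ) := by
    rw [hprod, hlin]
    have h := ENNReal.toReal_mono (ENNReal.mul_ne_top hfin
      (ENNReal.rpow_ne_top_of_nonneg (by norm_num) ENNReal.ofReal_ne_top)) hHolder
    rw [ENNReal.toReal_mul, ← ENNReal.toReal_rpow, ENNReal.toReal_ofReal (by linarith)] at h
    exact h
  have hint0 : 0 ≤ ∫ σ in Ioc s t, q σ := setIntegral_nonneg measurableSet_Ioc fun σ _ => hq0 σ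
  rw [abs_of_nonneg (by linarith : 0 ≤ (t - s) + ∫ σ in Ioc s t, q σ),
    abs_of_nonneg (by linarith : 0 ≤ t - s)]
  linarith

/-! ### Optimising the bump scale: a Hölder modulus in time on the good set -/

/-- **From the modulus at all dyadic-like scales to a Hölder modulus in time.** If
`‖v_t(y) - v_s(y)‖ ≤ 6 C δₙ^α + 3 (A₀ δₙ⁻⁵) |P t - P s|` for all `n`, `δₙ = δ₀/(n + 1)`, with
`|P t - P s| ≤ |t - s| + Λ |t - s|^{1/3}` and `‖v_t‖ ≤ M`, then
`‖v_t(y) - v_s(y)‖ ≤ K |t - s|^κ`, `κ = min(α/30, 1/6)` (choose `δₙ ≈ |t - s|^{1/30}` for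
`|t - s| ≤ δ₀^{30}`, and use the sup bound otherwise). [folklore] -/
theorem time_modulus_of_scales {vT : ℝ → EuclideanSpace ℝ (Fin 3) → EuclideanSpace ℝ (Fin 3)}
    {T : Set ℝ} {B' : Set (EuclideanSpace ℝ (Fin 3))} {P : ℝ → ℝ} {δ₀ A₀ Λ M : ℝ} {C α : ℝ≥0}
    (hδ₀0 : 0 < δ₀) (hδ₀1 : δ₀ ≤ 1) (hA₀ : 0 ≤ A₀) (hΛ : 0 ≤ Λ)
    (hkey : ∀ n : ℕ, ∀ t ∈ T, ∀ s ∈ T, ∀ y ∈ B',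
      ‖vT t y - vT s y‖ ≤ 6 * C * (δ₀ / ((n : ℝ) + 1)) ^ (α : ℝ) +
        3 * (A₀ / (δ₀ / ((n : ℝ) + 1)) ^ 5) * |P t - P s|)
    (hP : ∀ t ∈ T, ∀ s ∈ T, |P t - P s| ≤ |t - s| + Λ * |t - s| ^ (1 / 3 : ℝ))
    (hvM : ∀ t ∈ T, ∀ y ∈ B', ‖vT t y‖ ≤ M) :
    ∃ Kt : ℝ, 0 ≤ Kt ∧ ∀ t ∈ T, ∀ s ∈ T, ∀ y ∈ B',
      ‖vT t y - vT s y‖ ≤ Kt * |t - s| ^ ((min (α / 30) (1 / 6) : ℝ≥0) : ℝ) := by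
  set κ : ℝ≥0 := min (α / 30) (1 / 6) with hκ
  have hκα : (κ : ℝ) ≤ (α : ℝ) / 30 := by
    have : κ ≤ α / 30 := min_le_left _ _
    exact_mod_cast this
  have hκ6 : (κ : ℝ) ≤ 1 / 6 := by
    have : κ ≤ 1 / 6 := min_le_right _ _
    exact_mod_cast this
  set τ₀ : ℝ := δ₀ ^ (30 : ℝ) with hτ₀
  have hτ₀0 : 0 < τ₀ := Real.rpow_pos_of_pos hδ₀0 _
  have hτ₀1 : τ₀ ≤ 1 := Real.rpow_le_one hδ₀0.le hδ₀1 (by norm_num)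
  set Kt : ℝ := 6 * C + 96 * A₀ * (1 + Λ) + 2 * |M| / τ₀ ^ (κ : ℝ) with hKt
  have hKt0 : 0 ≤ Kt := by rw [hKt]; positivity
  refine ⟨Kt, hKt0, fun t ht s hs y hy => ?_⟩
  set τ : ℝ := |t - s| with hτ
  have hτnn : 0 ≤ τ := abs_nonneg _
  rcases hτnn.eq_or_lt with hτ0 | hτpos
  · -- `t = s`
    have hts : t - s = 0 := abs_eq_zero.1 hτ0.symm
    have : t = s := by linarith
    subst this
    rw [sub_self, norm_zero]
    positivity
  by_cases hsmall : τ ≤ τ₀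
  · -- the bump radius `d = τ^{1/30} ≤ δ₀`, realised within a factor two by some `δₙ`
    have hτ1 : τ ≤ 1 := hsmall.trans hτ₀1
    set d : ℝ := τ ^ (1 / 30 : ℝ) with hd
    have hdpos : 0 < d := Real.rpow_pos_of_pos hτpos _
    have hdδ₀ : d ≤ δ₀ := by
      have h := Real.rpow_le_rpow hτnn hsmall (by norm_num : (0 : ℝ) ≤ 1 / 30)
      rw [hτ₀, ← Real.rpow_mul hδ₀0.le] at h
      norm_num at h
      exact h
    obtain ⟨n, hn1, hn2⟩ := exists_nat_radius_near hdpos hdδ₀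
    set δn : ℝ := δ₀ / ((n : ℝ) + 1) with hδn
    have hδn0 : 0 < δn := by positivity
    have hk := hkey n t ht s hs y hy
    -- `|P t - P s| ≤ (1 + Λ) τ^{1/3}`
    have hP13 : |P t - P s| ≤ (1 + Λ) * τ ^ (1 / 3 : ℝ) := by
      have h1 : τ ≤ τ ^ (1 / 3 : ℝ) := by
        have := Real.rpow_le_rpow_of_exponent_ge hτpos hτ1 (by norm_num : (1 / 3 : ℝ) ≤ 1)
        rwa [Real.rpow_one] at this
      calc |P t - P s| ≤ τ + Λ * τ ^ (1 / 3 : ℝ) := hP t ht s hs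
        _ ≤ τ ^ (1 / 3 : ℝ) + Λ * τ ^ (1 / 3 : ℝ) := by linarith
        _ = (1 + Λ) * τ ^ (1 / 3 : ℝ) := by ring
    -- first term: `6 C δₙ^α ≤ 6 C d^α = 6 C τ^{α/30} ≤ 6 C τ^κ`
    have hterm1 : 6 * (C : ℝ) * δn ^ (α : ℝ) ≤ 6 * C * τ ^ (κ : ℝ) := by
      have h1 : δn ^ (α : ℝ) ≤ d ^ (α : ℝ) := Real.rpow_le_rpow hδn0.le hn2 α.2
      have h2 : d ^ (α : ℝ) = τ ^ ((α : ℝ) / 30) := by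
        rw [hd, ← Real.rpow_mul hτnn]; ring_nf
      have h3 : τ ^ ((α : ℝ) / 30) ≤ τ ^ (κ : ℝ) :=
        Real.rpow_le_rpow_of_exponent_ge hτpos hτ1 hκα
      calc 6 * (C : ℝ) * δn ^ (α : ℝ) ≤ 6 * C * d ^ (α : ℝ) := by gcongr
        _ ≤ 6 * C * τ ^ (κ : ℝ) := by rw [h2]; gcongr
    -- second term: `3 (A₀ δₙ⁻⁵) |P t - P s| ≤ 96 A₀ (1 + Λ) τ^{1/3 - 1/6} ≤ 96 A₀ (1 + Λ) τ^κ`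
    have hterm2 : 3 * (A₀ / δn ^ 5) * |P t - P s| ≤ 96 * A₀ * (1 + Λ) * τ ^ (κ : ℝ) := by
      have hδn5 : (d / 2) ^ 5 ≤ δn ^ 5 := pow_le_pow_left₀ (by positivity) hn1 5
      have hd5 : (d / 2) ^ 5 = τ ^ (1 / 6 : ℝ) / 32 := by
        rw [div_pow, hd, ← Real.rpow_natCast, ← Real.rpow_mul hτnn]
        norm_num
      have hτ16 : 0 < τ ^ (1 / 6 : ℝ) := Real.rpow_pos_of_pos hτpos _
      have hA_le : A₀ / δn ^ 5 ≤ 32 * A₀ / τ ^ (1 / 6 : ℝ) := by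
        calc A₀ / δn ^ 5 ≤ A₀ / (d / 2) ^ 5 := div_le_div_of_nonneg_left hA₀ (by positivity) hδn5
          _ = 32 * A₀ / τ ^ (1 / 6 : ℝ) := by rw [hd5]; field_simp
      calc 3 * (A₀ / δn ^ 5) * |P t - P s|
          ≤ 3 * (32 * A₀ / τ ^ (1 / 6 : ℝ)) * ((1 + Λ) * τ ^ (1 / 3 : ℝ)) := by gcongr
        _ = 96 * A₀ * (1 + Λ) * (τ ^ (1 / 3 : ℝ) / τ ^ (1 / 6 : ℝ)) := by ring
        _ = 96 * A₀ * (1 + Λ) * τ ^ (1 / 6 : ℝ) := by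
            rw [← Real.rpow_sub hτpos]; norm_num
        _ ≤ 96 * A₀ * (1 + Λ) * τ ^ (κ : ℝ) :=
            mul_le_mul_of_nonneg_left (Real.rpow_le_rpow_of_exponent_ge hτpos hτ1 hκ6)
              (by positivity)
    have h3 : 0 ≤ 2 * |M| / τ₀ ^ (κ : ℝ) * τ ^ (κ : ℝ) := by positivity
    calc ‖vT t y - vT s y‖ ≤ 6 * C * δn ^ (α : ℝ) + 3 * (A₀ / δn ^ 5) * |P t - P s| := hk
      _ ≤ 6 * C * τ ^ (κ : ℝ) + 96 * A₀ * (1 + Λ) * τ ^ (κ : ℝ) := add_le_add hterm1 hterm2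
      _ ≤ Kt * τ ^ (κ : ℝ) := by rw [hKt]; nlinarith
  · -- large gaps: the sup bound
    have hτ₀τ : τ₀ < τ := lt_of_not_ge hsmall
    have h1 : ‖vT t y - vT s y‖ ≤ 2 * |M| :=
      calc ‖vT t y - vT s y‖ ≤ ‖vT t y‖ + ‖vT s y‖ := norm_sub_le _ _
        _ ≤ M + M := add_le_add (hvM t ht y hy) (hvM s hs y hy)
        _ ≤ 2 * |M| := by linarith [le_abs_self M]
    have h2 : τ₀ ^ (κ : ℝ) ≤ τ ^ (κ : ℝ) := Real.rpow_le_rpow hτ₀0.le hτ₀τ.le κ.2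
    have hτ₀κ : 0 < τ₀ ^ (κ : ℝ) := Real.rpow_pos_of_pos hτ₀0 _
    have h3 : 2 * |M| ≤ 2 * |M| / τ₀ ^ (κ : ℝ) * τ ^ (κ : ℝ) := by
      rw [div_mul_eq_mul_div, le_div_iff₀ hτ₀κ]
      exact mul_le_mul_of_nonneg_left h2 (by positivity)
    have h4 : 2 * |M| / τ₀ ^ (κ : ℝ) * τ ^ (κ : ℝ) ≤ Kt * τ ^ (κ : ℝ) := by
      refine mul_le_mul_of_nonneg_right ?_ (by positivity)
      rw [hKt]
      have : 0 ≤ 6 * (C : ℝ) + 96 * A₀ * (1 + Λ) := by positivity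
      linarith
    linarith

/-! ### From bounds on a dense set of times to a Hölder bound for the product metric -/

/-- **A continuous function with Hölder slices on a dense set of times is Hölder for the product
metric.** Let `W` be continuous on `I × B'` (`I` open), `T ⊆ I` dense in `I`, `W(t, ·) = v_t` for
`t ∈ T`, with `‖v_t(y) - v_s(y)‖ ≤ K_t |t - s|^κ`, `‖v_t(y) - v_t(y')‖ ≤ C |y - y'|^α` (`κ ≤ α`) and
`‖v_t(y)‖ ≤ M` for `t, s ∈ T`, `y, y' ∈ B'`. Then `W` is `(K_t + C + 2|M|, κ)`-Hölder on `I × B'`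
for the product (max) metric (the bounds pass to `I` by continuity; small distances by the two
moduli, large ones by the sup bound). [folklore] -/
theorem holderOnWith_of_dense_bounds
    {W : ℝ × EuclideanSpace ℝ (Fin 3) → EuclideanSpace ℝ (Fin 3)} {I T : Set ℝ}
    {B' : Set (EuclideanSpace ℝ (Fin 3))}
    {vT : ℝ → EuclideanSpace ℝ (Fin 3) → EuclideanSpace ℝ (Fin 3)}
    (hTI : T ⊆ I) (hTcl : I ⊆ closure T)
    (hWc : ContinuousOn W (I ×ˢ B')) (hWT : ∀ t ∈ T, ∀ y ∈ B', W (t, y) = vT t y)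
    {Kt M : ℝ} {C α κ : ℝ≥0} (hκ0 : 0 < κ) (hκα : κ ≤ α) (hKt : 0 ≤ Kt)
    (htime : ∀ t ∈ T, ∀ s ∈ T, ∀ y ∈ B', ‖vT t y - vT s y‖ ≤ Kt * |t - s| ^ (κ : ℝ))
    (hspace : ∀ t ∈ T, ∀ y ∈ B', ∀ y' ∈ B', ‖vT t y - vT t y'‖ ≤ C * dist y y' ^ (α : ℝ))
    (hsup : ∀ t ∈ T, ∀ y ∈ B', ‖vT t y‖ ≤ M) :
    HolderOnWith (Kt + C + 2 * |M|).toNNReal κ W (I ×ˢ B') := by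
  have hα0 : 0 < α := hκ0.trans_le hκα
  have hκα' : (κ : ℝ) ≤ (α : ℝ) := by exact_mod_cast hκα
  -- passing bounds from `T` to `I` by continuity
  have hWcont : ∀ y ∈ B', ContinuousOn (fun t : ℝ => W (t, y)) I := fun y hy =>
    hWc.comp (continuousOn_id.prodMk continuousOn_const) fun t ht => ⟨ht, hy⟩
  have hdense : ∀ {f g : ℝ → ℝ}, ContinuousOn f I → ContinuousOn g I →
      (∀ t ∈ T, f t ≤ g t) → ∀ t ∈ I, f t ≤ g t := by
    intro f g hf hg hfg t ht
    exact ContinuousWithinAt.closure_le (hTcl ht) ((hf.continuousWithinAt ht).mono hTI)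
      ((hg.continuousWithinAt ht).mono hTI) hfg
  have hrpowc : ∀ s : ℝ, Continuous fun t : ℝ => Kt * |t - s| ^ (κ : ℝ) := fun s =>
    continuous_const.mul ((continuous_abs.comp (continuous_id.sub continuous_const)).rpow_const
      fun _ => Or.inr κ.2)
  -- (a) time bound, one endpoint good
  have ha : ∀ t ∈ I, ∀ s ∈ T, ∀ y ∈ B', ‖W (t, y) - W (s, y)‖ ≤ Kt * |t - s| ^ (κ : ℝ) := by
    intro t ht s hs y hy
    refine hdense (f := fun t => ‖W (t, y) - W (s, y)‖) (g := fun t => Kt * |t - s| ^ (κ : ℝ))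
      (((hWcont y hy).sub continuousOn_const).norm) (hrpowc s).continuousOn (fun t' ht' => ?_) t ht
    rw [hWT t' ht' y hy, hWT s hs y hy]
    exact htime t' ht' s hs y hy
  -- (b) time bound, both endpoints arbitrary
  have hb : ∀ t ∈ I, ∀ s ∈ I, ∀ y ∈ B', ‖W (t, y) - W (s, y)‖ ≤ Kt * |t - s| ^ (κ : ℝ) := by
    intro t ht s hs y hy
    have hcs : ContinuousOn (fun s : ℝ => Kt * |t - s| ^ (κ : ℝ)) I := by
      have : (fun s : ℝ => Kt * |t - s| ^ (κ : ℝ)) = fun s => Kt * |s - t| ^ (κ : ℝ) := by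
        funext s'; rw [abs_sub_comm]
      rw [this]
      exact (hrpowc t).continuousOn
    exact hdense (f := fun s => ‖W (t, y) - W (s, y)‖) (g := fun s => Kt * |t - s| ^ (κ : ℝ))
      ((continuousOn_const.sub (hWcont y hy)).norm) hcs (fun s' hs' => ha t ht s' hs' y hy) s hs
  -- (c) spatial Hölder bound at every time
  have hc : ∀ t ∈ I, ∀ y ∈ B', ∀ y' ∈ B', ‖W (t, y) - W (t, y')‖ ≤ C * dist y y' ^ (α : ℝ) := by
    intro t ht y hy y' hy'
    refine hdense (f := fun t => ‖W (t, y) - W (t, y')‖) (g := fun _ => C * dist y y' ^ (α : ℝ))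
      (((hWcont y hy).sub (hWcont y' hy')).norm) continuousOn_const (fun t' ht' => ?_) t ht
    rw [hWT t' ht' y hy, hWT t' ht' y' hy']
    exact hspace t' ht' y hy y' hy'
  -- (d) the sup bound at every time
  have hd : ∀ t ∈ I, ∀ y ∈ B', ‖W (t, y)‖ ≤ M := by
    intro t ht y hy
    refine hdense (f := fun t => ‖W (t, y)‖) (g := fun _ => M) (hWcont y hy).norm
      continuousOn_const (fun t' ht' => ?_) t ht
    rw [hWT t' ht' y hy]
    exact hsup t' ht' y hy
  -- the Hölder bound for the product metric
  set K : ℝ := Kt + C + 2 * |M| with hK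
  have hK0 : 0 ≤ K := by rw [hK]; positivity
  refine holderOnWith_of_norm_sub_le fun q₁ h₁ q₂ h₂ => ?_
  rw [Real.coe_toNNReal _ hK0]
  obtain ⟨t, y⟩ := q₁
  obtain ⟨s, y'⟩ := q₂
  obtain ⟨ht, hy⟩ := h₁
  obtain ⟨hs, hy'⟩ := h₂
  set D : ℝ := dist (t, y) (s, y') with hD
  have hD0 : 0 ≤ D := dist_nonneg
  have hDt : |t - s| ≤ D := by
    rw [hD, Prod.dist_eq, ← Real.dist_eq]; exact le_max_left _ _
  have hDy : dist y y' ≤ D := by rw [hD, Prod.dist_eq]; exact le_max_right _ _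
  have htri : ‖W (t, y) - W (s, y')‖ ≤ Kt * |t - s| ^ (κ : ℝ) + C * dist y y' ^ (α : ℝ) :=
    calc ‖W (t, y) - W (s, y')‖ ≤ ‖W (t, y) - W (s, y)‖ + ‖W (s, y) - W (s, y')‖ :=
          norm_sub_le_norm_sub_add_norm_sub _ _ _
      _ ≤ Kt * |t - s| ^ (κ : ℝ) + C * dist y y' ^ (α : ℝ) :=
          add_le_add (hb t ht s hs y hy) (hc s hs y hy y' hy')
  by_cases hD1 : D ≤ 1
  · have h1 : |t - s| ^ (κ : ℝ) ≤ D ^ (κ : ℝ) := Real.rpow_le_rpow (abs_nonneg _) hDt κ.2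
    have h2 : dist y y' ^ (α : ℝ) ≤ D ^ (κ : ℝ) :=
      calc dist y y' ^ (α : ℝ) ≤ D ^ (α : ℝ) := Real.rpow_le_rpow dist_nonneg hDy α.2
        _ ≤ D ^ (κ : ℝ) := by
            rcases hD0.eq_or_lt with h | h
            · rw [← h, Real.zero_rpow (NNReal.coe_pos.2 hα0).ne',
                Real.zero_rpow (NNReal.coe_pos.2 hκ0).ne']
            · exact Real.rpow_le_rpow_of_exponent_ge h hD1 hκα'
    have h3 : 0 ≤ 2 * |M| * D ^ (κ : ℝ) := by positivity
    calc ‖W (t, y) - W (s, y')‖ ≤ Kt * |t - s| ^ (κ : ℝ) + C * dist y y' ^ (α : ℝ) := htri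
      _ ≤ Kt * D ^ (κ : ℝ) + C * D ^ (κ : ℝ) := by gcongr
      _ ≤ K * D ^ (κ : ℝ) := by rw [hK]; nlinarith
  · have hD1' : 1 ≤ D ^ (κ : ℝ) := Real.one_le_rpow (le_of_not_ge hD1) κ.2
    have hsupb : ‖W (t, y) - W (s, y')‖ ≤ 2 * |M| :=
      calc ‖W (t, y) - W (s, y')‖ ≤ ‖W (t, y)‖ + ‖W (s, y')‖ := norm_sub_le _ _
        _ ≤ M + M := add_le_add (hd t ht y hy) (hd s hs y' hy')
        _ ≤ 2 * |M| := by linarith [le_abs_self M]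
    have h4 : 0 ≤ (Kt + C) * D ^ (κ : ℝ) := by positivity
    calc ‖W (t, y) - W (s, y')‖ ≤ 2 * |M| := hsupb
      _ ≤ 2 * |M| * D ^ (κ : ℝ) := le_mul_of_one_le_right (by positivity) hD1'
      _ ≤ K * D ^ (κ : ℝ) := by rw [hK]; nlinarith

/-! ### The Hölder representative -/

/-- **Bounded local weak solutions with Hölder slices are Hölder in space–time, up to both ends
of the time window** (quantitative form of the accepted `NSSliceTimeContinuity_holds`; folklore,
Robinson–Rodrigo–Sadowski 2016, §13.5). Let `(u, p)` solve the Navier–Stokes system (`ν = 1`, no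
force) in the sense of distributions in `Q*_R(z) = I × B`, with `|u| ≤ M` a.e.,
`p ∈ L_{3/2}(Q*_R(z))`, and suppose that for a.e. `t ∈ I` the slice `u(t, ·)` agrees a.e. on `B`
with a `(C, α)`-Hölder field, `α > 0`. Then for every `0 < r < R` there are `W`, `K` and `κ > 0`
with `W` `(K, κ)`-Hölder on `I × B(x₀, r)` for the product metric of `ℝ × ℝ³` and `u = W` a.e.
there. Proof: module docstring. [cite: RobinsonRodrigoSadowskiCUP2016, §13.5 (time regularity through the pressure); folklore] -/
theorem exists_holderOnWith_representative
    (u : ℝ → EuclideanSpace ℝ (Fin 3) → EuclideanSpace ℝ (Fin 3))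
    (p : ℝ → EuclideanSpace ℝ (Fin 3) → ℝ) (z : ℝ × EuclideanSpace ℝ (Fin 3)) (R M : ℝ) (C α : ℝ≥0)
    (hα : 0 < α)
    (hsol : IsDistributionalNSSolutionOn (parabolicCylinderCenteredOpens R z) 1 0 u p)
    (hbd : ∀ᵐ w ∂(volume.restrict (parabolicCylinderCentered R z)), ‖u w.1 w.2‖ ≤ M)
    (hp : ∫⁻ w in parabolicCylinderCentered R z, ‖p w.1 w.2‖ₑ ^ (3 / 2 : ℝ) < ∞)
    (hH : ∀ᵐ t ∂(volume.restrict (Ioo (z.1 - R ^ 2) (z.1 + R ^ 2))),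
      ∃ v : EuclideanSpace ℝ (Fin 3) → EuclideanSpace ℝ (Fin 3),
        HolderOnWith C α v (ball z.2 R) ∧ u t =ᵐ[volume.restrict (ball z.2 R)] v)
    {r : ℝ} (hr : r ∈ Ioo 0 R) :
    ∃ (W : ℝ × EuclideanSpace ℝ (Fin 3) → EuclideanSpace ℝ (Fin 3)) (K κ : ℝ≥0), 0 < κ ∧
      HolderOnWith K κ W (Ioo (z.1 - R ^ 2) (z.1 + R ^ 2) ×ˢ ball z.2 r) ∧
      uncurry u =ᵐ[volume.restrict (Ioo (z.1 - R ^ 2) (z.1 + R ^ 2) ×ˢ ball z.2 r)] W := by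
  obtain ⟨hr0, hrR⟩ := hr
  have hR0 : 0 < R := hr0.trans hrR
  set a : ℝ := z.1 - R ^ 2 with ha
  set b : ℝ := z.1 + R ^ 2 with hb
  set B : Set (EuclideanSpace ℝ (Fin 3)) := ball z.2 R with hB
  set B' : Set (EuclideanSpace ℝ (Fin 3)) := ball z.2 r with hB'
  have hB'B : B' ⊆ B := ball_subset_ball hrR.le
  have hpi : IntegrableOn (uncurry p) (parabolicCylinderCentered R z) volume :=
    integrableOn_pressure_of_lintegral hsol hp
  -- the bump scales `δ n = δ₀/(n+1)`, `δ₀ = min 1 ((R - r)/2)`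
  obtain ⟨k₁, k₂, hk₁, hk₂, hfam⟩ := exists_scaled_bump_bounds
  set δ₀ : ℝ := min 1 ((R - r) / 2) with hδ₀
  have hδ₀0 : 0 < δ₀ := lt_min one_pos (by linarith)
  have hδ₀1 : δ₀ ≤ 1 := min_le_left _ _
  have hδ₀R : δ₀ < R - r := (min_le_right _ _).trans_lt (by linarith)
  set δ : ℕ → ℝ := fun n => δ₀ / ((n : ℝ) + 1) with hδ
  have hδ0 : ∀ n, 0 < δ n := fun n => by positivity
  have hδle : ∀ n, δ n ≤ δ₀ := fun n => by
    rw [hδ]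
    exact div_le_self hδ₀0.le (by linarith [n.cast_nonneg (α := ℝ)])
  have hδ1 : ∀ n, δ n ≤ 1 := fun n => (hδle n).trans hδ₀1
  have hδlt : ∀ n, δ n < R - r := fun n => (hδle n).trans_lt hδ₀R
  have hφex : ∀ n, ∃ φ : ContDiffBump (0 : EuclideanSpace ℝ (Fin 3)), φ.rOut = δ n ∧
      ∀ (v q x : EuclideanSpace ℝ (Fin 3)),
        ‖fderiv ℝ (fun y => φ.normed volume (y - q) • v) x‖ ≤ k₁ * ‖v‖ / δ n ^ 4 ∧
        ‖Δ (fun y => φ.normed volume (y - q) • v) x‖ ≤ k₂ * ‖v‖ / δ n ^ 5 :=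
    fun n => hfam (δ n) (hδ0 n) (hδ1 n)
  choose φ hφ hφbd using hφex
  -- the basis vectors and a dense sequence of centres
  set e := EuclideanSpace.basisFun (Fin 3) ℝ with he
  obtain ⟨q, hq⟩ := TopologicalSpace.exists_dense_seq (EuclideanSpace ℝ (Fin 3))
  -- the test fields, their quantitative bounds, and the test property for centres in `B'`
  set η : ℕ → ℕ → Fin 3 → (EuclideanSpace ℝ (Fin 3)) → (EuclideanSpace ℝ (Fin 3)) :=
    fun n k i y => (φ n).normed volume (y - q k) • e i with hη
  set K₁ : ℕ → ℝ := fun n => k₁ / δ n ^ 4 with hK₁d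
  set K₂ : ℕ → ℝ := fun n => k₂ / δ n ^ 5 with hK₂d
  have hK₁ : ∀ n k i x, ‖fderiv ℝ (η n k i) x‖ ≤ K₁ n := fun n k i x => by
    have h := (hφbd n (e i) (q k) x).1
    rwa [show ‖e i‖ = 1 from e.norm_eq_one i, mul_one] at h
  have hK₂ : ∀ n k i x, ‖Δ (η n k i) x‖ ≤ K₂ n := fun n k i x => by
    have h := (hφbd n (e i) (q k) x).2
    rwa [show ‖e i‖ = 1 from e.norm_eq_one i, mul_one] at h
  have hcb : ∀ n k, q k ∈ B' → closedBall (q k) (φ n).rOut ⊆ B := by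
    intro n k hk x hx
    rw [mem_closedBall, hφ] at hx
    rw [hB', mem_ball] at hk
    rw [hB, mem_ball]
    linarith [dist_triangle x (q k) z.2, hδlt n]
  have htest : ∀ n k i, q k ∈ B' →
      FunctionSpaces.IsTestFunctionOn ⟨B, isOpen_ball⟩ (η n k i) := fun n k i hk =>
    isTestFunctionOn_bump_smul (φ n) (q k) (e i) isOpen_ball (hcb n k hk)
  -- pairings, remainders, primitives, pressure clock, constants
  set g : ℕ → ℕ → Fin 3 → ℝ → ℝ := fun n k i t => ∫ x in B, ⟪u t x, η n k i x⟫ with hg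
  set F : ℕ → ℕ → Fin 3 → ℝ → ℝ := fun n k i s => ∫ x in B,
    (⟪u s x, fderiv ℝ (η n k i) x (u s x)⟫ + ⟪u s x, Δ (η n k i) x⟫ +
      p s x * VectorCalculus.divergence (η n k i) x) with hF
  set V : ℕ → ℕ → Fin 3 → ℝ → ℝ := fun n k i t => ∫ s in Ioc a t, F n k i s with hV
  set P : ℝ → ℝ := fun t => ∫ s in Ioc a t, (1 + ∫ x in B, |p s x|) with hP
  set A : ℕ → ℝ := fun n =>
    |(volume B).toReal * (K₁ n * M ^ 2 + K₂ n * M)| + 3 * |K₁ n| with hA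
  -- Step 1: the a.e. representations and the increment bounds
  have hrep : ∀ n k i, ∃ c : ℝ, q k ∈ B' → ∀ᵐ t ∂(volume.restrict (Ioo a b)),
      g n k i t = c + V n k i t := by
    intro n k i
    by_cases hk : q k ∈ B'
    · obtain ⟨c, hc⟩ := exists_ae_pairing_eq_const_add_primitive hsol hbd hpi (htest n k i hk)
      exact ⟨c, fun _ => hc⟩
    · exact ⟨0, fun h => absurd h hk⟩
  choose c hc using hrep
  have hinc : ∀ n k i, q k ∈ B' → ∀ t ∈ Icc a b, ∀ s ∈ Icc a b,
      |V n k i t - V n k i s| ≤ A n * |P t - P s| := fun n k i hk t ht s hs =>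
    abs_primitive_sub_primitive_le hsol hbd hpi (htest n k i hk) (hK₁ n k i) (hK₂ n k i) ht hs
  -- Step 2: the good set of times (Hölder slice, slice bound, all pairing identities)
  have hbds : ∀ᵐ t ∂(volume.restrict (Ioo a b)), ∀ᵐ x ∂(volume.restrict B), ‖u t x‖ ≤ M :=
    ae_ae_norm_slice_le hbd
  set T : Set ℝ := {t | t ∈ Ioo a b ∧
    (∃ v : (EuclideanSpace ℝ (Fin 3)) → (EuclideanSpace ℝ (Fin 3)),
      HolderOnWith C α v B ∧ u t =ᵐ[volume.restrict B] v) ∧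
    (∀ᵐ x ∂(volume.restrict B), ‖u t x‖ ≤ M) ∧
    ∀ n k i, q k ∈ B' → g n k i t = c n k i + V n k i t} with hT
  have hTfull : ∀ᵐ t ∂(volume.restrict (Ioo a b)), t ∈ T := by
    have h1 : ∀ᵐ t ∂(volume.restrict (Ioo a b)), t ∈ Ioo a b := ae_restrict_mem measurableSet_Ioo
    have h3 : ∀ᵐ t ∂(volume.restrict (Ioo a b)), ∀ n k i, q k ∈ B' →
        g n k i t = c n k i + V n k i t := by
      rw [ae_all_iff]; intro n
      rw [ae_all_iff]; intro k
      rw [ae_all_iff]; intro i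
      by_cases hk : q k ∈ B'
      · filter_upwards [hc n k i hk] with t ht _ using ht
      · exact Eventually.of_forall fun t h => absurd h hk
    filter_upwards [h1, hH, hbds, h3] with t h1t h2t h4t h3t
    exact ⟨h1t, h2t, h4t, h3t⟩
  have hTI : T ⊆ Ioo a b := fun t ht => ht.1
  have hTcl : Ioo a b ⊆ closure T := subset_closure_of_ae_restrict_mem isOpen_Ioo hTfull
  -- Step 3: the Hölder representatives at good times, and their sup bound
  have hvex : ∀ t, ∃ v : (EuclideanSpace ℝ (Fin 3)) → (EuclideanSpace ℝ (Fin 3)), t ∈ T →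
      HolderOnWith C α v B ∧ u t =ᵐ[volume.restrict B] v := by
    intro t
    by_cases ht : t ∈ T
    · obtain ⟨v, hv⟩ := ht.2.1
      exact ⟨v, fun _ => hv⟩
    · exact ⟨0, fun h => absurd h ht⟩
  choose vT hvT using hvex
  have hgv : ∀ t ∈ T, ∀ n k i, g n k i t = ∫ x in B, ⟪vT t x, η n k i x⟫ := by
    intro t ht n k i
    refine integral_congr_ae ?_
    filter_upwards [(hvT t ht).2] with x hx
    rw [hx]
  -- an a.e. bound on a continuous function on the (open) ball holds everywhere
  have hnormle : ∀ {f : EuclideanSpace ℝ (Fin 3) → EuclideanSpace ℝ (Fin 3)},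
      ContinuousOn f B → (∀ᵐ x ∂(volume.restrict B), ‖f x‖ ≤ M) → ∀ x ∈ B, ‖f x‖ ≤ M := by
    intro f hf h
    by_contra hcon
    push Not at hcon
    obtain ⟨x, hxB, hx⟩ := hcon
    have hopen : IsOpen (B ∩ (fun w => ‖f w‖) ⁻¹' Ioi M) :=
      hf.norm.isOpen_inter_preimage isOpen_ball isOpen_Ioi
    have hpos : 0 < volume (B ∩ (fun w => ‖f w‖) ⁻¹' Ioi M) :=
      hopen.measure_pos volume ⟨x, hxB, hx⟩
    have hnull : volume.restrict B {w | ¬‖f w‖ ≤ M} = 0 := ae_iff.1 h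
    rw [Measure.restrict_apply' measurableSet_ball] at hnull
    have hsub : B ∩ (fun w => ‖f w‖) ⁻¹' Ioi M ⊆ {w | ¬‖f w‖ ≤ M} ∩ B :=
      fun w hw => ⟨not_le.2 hw.2, hw.1⟩
    exact hpos.ne' (measure_mono_null hsub hnull)
  have hvM : ∀ t ∈ T, ∀ y ∈ B, ‖vT t y‖ ≤ M := by
    intro t ht
    refine hnormle ((hvT t ht).1.continuousOn hα) ?_
    filter_upwards [ht.2.2.1, (hvT t ht).2] with x hx hx'
    rw [← hx']
    exact hx
  -- Step 4: the key estimate between two good slices, for every bump scale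
  have hkey : ∀ n, ∀ t ∈ T, ∀ s ∈ T, ∀ y ∈ B',
      ‖vT t y - vT s y‖ ≤ 6 * C * δ n ^ ((α : ℝ)) + (∑ _i : Fin 3, A n) * |P t - P s| := by
    intro n t ht s hs y hy
    have hφn : (φ n).rOut < R - r := by rw [hφ]; exact hδlt n
    have key := norm_sub_le_of_bump_pairings hα (hvT t ht).1 (hvT s hs).1 (φ n) hφn hq
      (A := fun _ => A n) (D := |P t - P s|) (fun k i hk => ?_) hy
    · rw [hφ] at key
      exact key
    · show |(∫ x in B, ⟪vT t x, η n k i x⟫) - ∫ x in B, ⟪vT s x, η n k i x⟫| ≤ A n * |P t - P s|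
      rw [← hgv t ht n k i, ← hgv s hs n k i, ht.2.2.2 n k i hk, hs.2.2.2 n k i hk,
        add_sub_add_left_eq_sub]
      exact hinc n k i hk t (Ioo_subset_Icc_self ht.1) s (Ioo_subset_Icc_self hs.1)
  -- Step 5: the pressure clock is continuous; uniformly Cauchy; the continuous limit `W`
  have hPc : ∀ τ ∈ Ioo a b, ContinuousAt P τ := fun τ hτ =>
    (continuousOn_pressureClock hpi).continuousAt (Icc_mem_nhds hτ.1 hτ.2)
  have hδlim : Tendsto δ atTop (𝓝 0) := by
    have h1 : Tendsto (fun n : ℕ => (n : ℝ) + 1) atTop atTop :=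
      tendsto_atTop_add_const_right _ 1 tendsto_natCast_atTop_atTop
    exact tendsto_const_nhds.div_atTop h1
  have hω : Tendsto (fun n => 6 * (C : ℝ) * δ n ^ (α : ℝ)) atTop (𝓝 0) := by
    have h1 : Tendsto (fun n => δ n ^ (α : ℝ)) atTop (𝓝 0) := by
      have := hδlim.rpow_const (p := (α : ℝ)) (Or.inr α.2)
      rwa [Real.zero_rpow (NNReal.coe_pos.2 hα).ne'] at this
    simpa using h1.const_mul (6 * (C : ℝ))
  have hosc := uniformly_cauchy_of_modulus (O := B') hPc hω hkey
  have hvc : ∀ t ∈ T, ContinuousOn (vT t) B' := fun t ht =>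
    ((hvT t ht).1.continuousOn hα).mono hB'B
  obtain ⟨W, hWc, hWT⟩ := exists_continuousOn_of_uniformly_cauchy_slices hTI hTcl hvc hosc
  -- Step 6: the quantitative time modulus on the good set
  set Λ : ℝ := ((∫⁻ w in parabolicCylinderCentered R z, ‖p w.1 w.2‖ₑ ^ (3 / 2 : ℝ)) ^ (2 / 3 : ℝ) *
    volume (ball z.2 R) ^ (1 / 3 : ℝ)).toReal with hΛ
  have hΛ0 : 0 ≤ Λ := ENNReal.toReal_nonneg
  set A₀ : ℝ := (volume B).toReal * (k₁ * M ^ 2 + k₂ * |M|) + 3 * k₁ with hA₀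
  have hvolB : 0 ≤ (volume B).toReal := ENNReal.toReal_nonneg
  have hA₀0 : 0 ≤ A₀ := by
    have : 0 ≤ k₁ * M ^ 2 + k₂ * |M| := by positivity
    rw [hA₀]; positivity
  have hAn : ∀ n, A n ≤ A₀ / δ n ^ 5 := by
    intro n
    have hd := hδ0 n
    have hd4 : δ n ^ 5 ≤ δ n ^ 4 := pow_le_pow_of_le_one hd.le (hδ1 n) (by norm_num)
    have hK₁n : 0 ≤ K₁ n := by rw [hK₁d]; positivity
    have hK₂n : 0 ≤ K₂ n := by rw [hK₂d]; positivity
    have hK₁le : K₁ n ≤ k₁ / δ n ^ 5 := div_le_div_of_nonneg_left hk₁ (by positivity) hd4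
    have hK₂e : K₂ n = k₂ / δ n ^ 5 := rfl
    have h1 : |(volume B).toReal * (K₁ n * M ^ 2 + K₂ n * M)| ≤
        (volume B).toReal * (k₁ / δ n ^ 5 * M ^ 2 + k₂ / δ n ^ 5 * |M|) := by
      rw [abs_mul, abs_of_nonneg hvolB]
      refine mul_le_mul_of_nonneg_left ?_ hvolB
      calc |K₁ n * M ^ 2 + K₂ n * M| ≤ |K₁ n * M ^ 2| + |K₂ n * M| := abs_add_le _ _
        _ = K₁ n * M ^ 2 + K₂ n * |M| := by
            rw [abs_mul, abs_mul, abs_of_nonneg hK₁n, abs_of_nonneg hK₂n, abs_of_nonneg (sq_nonneg M)]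
        _ ≤ k₁ / δ n ^ 5 * M ^ 2 + k₂ / δ n ^ 5 * |M| := by rw [hK₂e]; gcongr
    have h2 : 3 * |K₁ n| ≤ 3 * (k₁ / δ n ^ 5) := by rw [abs_of_nonneg hK₁n]; linarith
    calc A n ≤ (volume B).toReal * (k₁ / δ n ^ 5 * M ^ 2 + k₂ / δ n ^ 5 * |M|) + 3 * (k₁ / δ n ^ 5) :=
          add_le_add h1 h2
      _ = A₀ / δ n ^ 5 := by rw [hA₀]; field_simp
  have hkey' : ∀ n : ℕ, ∀ t ∈ T, ∀ s ∈ T, ∀ y ∈ B',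
      ‖vT t y - vT s y‖ ≤ 6 * C * (δ₀ / ((n : ℝ) + 1)) ^ (α : ℝ) +
        3 * (A₀ / (δ₀ / ((n : ℝ) + 1)) ^ 5) * |P t - P s| := by
    intro n t ht s hs y hy
    have h := hkey n t ht s hs y hy
    have hsumA : (∑ _i : Fin 3, A n) = 3 * A n := by simp
    rw [hsumA] at h
    have hδn : δ n = δ₀ / ((n : ℝ) + 1) := rfl
    rw [← hδn]
    have h2 : 3 * A n * |P t - P s| ≤ 3 * (A₀ / δ n ^ 5) * |P t - P s| := by
      gcongr; exact hAn n
    linarith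
  have hPmod : ∀ t ∈ T, ∀ s ∈ T, |P t - P s| ≤ |t - s| + Λ * |t - s| ^ (1 / 3 : ℝ) :=
    fun t ht s hs => abs_pressureClock_sub_le hp hpi (Ioo_subset_Icc_self hs.1)
      (Ioo_subset_Icc_self ht.1)
  obtain ⟨Kt, hKt0, htime⟩ := time_modulus_of_scales (B' := B') hδ₀0 hδ₀1 hA₀0 hΛ0 hkey' hPmod
    (fun t ht y hy => hvM t ht y (hB'B hy))
  -- Step 7: the Hölder bound for the product metric, and the a.e. equality
  set κ : ℝ≥0 := min (α / 30) (1 / 6) with hκ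
  have hκ0 : 0 < κ := lt_min (by positivity) (by norm_num)
  have hκα : κ ≤ α := (min_le_left _ _).trans (by
    rw [div_le_iff₀ (by norm_num : (0 : ℝ≥0) < 30)]
    have : (1 : ℝ≥0) ≤ 30 := by norm_num
    calc α = α * 1 := (mul_one α).symm
      _ ≤ α * 30 := by gcongr)
  have hspace : ∀ t ∈ T, ∀ y ∈ B', ∀ y' ∈ B', ‖vT t y - vT t y'‖ ≤ C * dist y y' ^ (α : ℝ) := by
    intro t ht y hy y' hy'
    rw [← dist_eq_norm]
    exact (hvT t ht).1.dist_le (hB'B hy) (hB'B hy')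
  refine ⟨W, (Kt + C + 2 * |M|).toNNReal, κ, hκ0, ?_, ?_⟩
  · exact holderOnWith_of_dense_bounds hTI hTcl hWc hWT hκ0 hκα hKt0 htime hspace
      (fun t ht y hy => hvM t ht y (hB'B hy))
  · refine ae_eq_restrict_prod_of_ae_ae ?_ ?_ ?_
    · have hsub : Ioo a b ×ˢ B' ⊆ parabolicCylinderCentered R z := prod_mono Subset.rfl hB'B
      exact (hsol.1.mono_set hsub).aestronglyMeasurable
    · exact hWc.aestronglyMeasurable (measurableSet_Ioo.prod measurableSet_ball)
    · filter_upwards [hTfull] with t ht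
      filter_upwards [ae_restrict_of_ae_restrict_of_subset hB'B (hvT t ht).2,
        ae_restrict_mem measurableSet_ball] with y hy hyB'
      simp only [uncurry_apply_pair]
      rw [hWT t ht y hyB', hy]

end SliceTimeHolder

end Literature.Analysis.FluidPDE

end
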